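import Summits.Ventures.HodgeKum4.Theorems.KummerFixedLocusInvolutionParity
import Summits.Ventures.HodgeKum4.Theorems.KummerFixedLocusI2Closing
import Summits.Ventures.HodgeKum4.Theorems.KummerFixedLocusL3Derivation
import Summits.Ventures.HodgeKum4.Theorems.KummerFixedLocusTranslationGroup
import HarnessLib

/-!
# Crux I and L3° from print + André's guarded fact + L1, modulo the geometric residual I1geo
(cell `hodge-kum4`, seat p2 — summary theorems)

HONEST FRAMING.  PROVED implications (all inputs named; the theorems are CONDITIONAL on the printed
facts, on L1 and on the residual):
* `kum4FixedFourfoldClasses_of_L1_of_meetsTranslates` : printed facts (A1 Hirzebruch, A2 Floccari,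
  Voisin HI/HR, Göttsche–Soergel, GKLR, Foster, Floccari `|Γ| = 625`, Fulton transversal point, André's
  GUARDED dual-Lefschetz fact) → L1 (`LefschetzGenerationKum4`, seat p1's crux) → I1geo
  (`Kum4FixedFourfoldMeetsTranslates`, THE residual, `@[conjecture]`) → crux I (`Kum4FixedFourfoldClasses`);
* `kum4NonInvariantClassesAlgebraic_of_L1_of_meetsTranslates` : the same inputs → L3°
  (`Kum4NonInvariantClassesAlgebraic`).
(The route's own `PolarizationHasDualLefschetz` is unguarded — false at `n = 0` — and is NOT used:
referee REF-AUDIT-8 §2; André's printed fact is the guarded form.)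
-/

noncomputable section

open DirectSum CategoryTheory
open Literature.AlgebraicTopology.SingularHomology
open Literature.Geometry.Kaehler
open Literature.AlgebraicGeometry Literature.AlgebraicGeometry.HodgeTheory
open Literature.AlgebraicGeometry.Hyperkaehler (Floccari2026_fixedFourfold_kum4Type
  Floccari2026_card_autFixingH2H3_kum4Type Foster2024_translationAction_kum4Type
  GreenKimLazaRobles2022_llvTrivial_isOfHodgeType_kumType GoettscheSoergel1993_chiY_kum4Type
  IsOfGeneralizedKummerType totalPullback totalPullback_lof ofDegree IsDualLefschetz opCupSpan
  degreeClasses)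

namespace Summit.Ventures.HodgeKum4

/-- **Crux I from print + André's guarded fact + L1, modulo the geometric residual I1geo**
(`Kum4FixedFourfoldMeetsTranslates`: `W ×_X gW` is one reduced point; the printed Fulton fact
supplies the intersection numbers `±1` through `kum4FixedFourfoldTranslatesR_of_meetsTranslates`). -/
theorem kum4FixedFourfoldClasses_of_L1_of_meetsTranslates
    (hA1 : Hirzebruch1969_gSignature_involution_halfDimFixedLocus)
    (hA2 : Floccari2026_fixedFourfold_kum4Type)
    (hHIR : Voisin2002_hodgeIndex_hodgeRiemann_middle)
    (hGS : GoettscheSoergel1993_chiY_kum4Type)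
    (hGK : GreenKimLazaRobles2022_llvTrivial_isOfHodgeType_kumType)
    (hF : Foster2024_translationAction_kum4Type)
    (hcardF : Floccari2026_card_autFixingH2H3_kum4Type)
    (hFu : Fulton1998_cupPairing_transversalPoint)
    (hS1 : Andre1996_dualLefschetz_mem_adjoin_lefschetzInvolution)
    (hL1 : LefschetzGenerationKum4)
    (hgeo : Kum4FixedFourfoldMeetsTranslates) :
    Summit.Ventures.HodgeKum4.Kum4FixedFourfoldClasses :=
  kum4FixedFourfoldClasses_of_facts hA1 hA2 hHIR hGS hGK hF hcardF
    (kum4InvolutionFixesInvariantMiddleClasses_of hS1 hL1) hFu hgeo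

/-- **L3° from print + André's guarded fact + L1, modulo the geometric residual I1geo.** -/
theorem kum4NonInvariantClassesAlgebraic_of_L1_of_meetsTranslates
    (hA1 : Hirzebruch1969_gSignature_involution_halfDimFixedLocus)
    (hA2 : Floccari2026_fixedFourfold_kum4Type)
    (hHIR : Voisin2002_hodgeIndex_hodgeRiemann_middle)
    (hGS : GoettscheSoergel1993_chiY_kum4Type)
    (hGK : GreenKimLazaRobles2022_llvTrivial_isOfHodgeType_kumType)
    (hF : Foster2024_translationAction_kum4Type)
    (hcardF : Floccari2026_card_autFixingH2H3_kum4Type)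
    (hFu : Fulton1998_cupPairing_transversalPoint)
    (hS1 : Andre1996_dualLefschetz_mem_adjoin_lefschetzInvolution)
    (hL1 : LefschetzGenerationKum4)
    (hgeo : Kum4FixedFourfoldMeetsTranslates) :
    Summit.Ventures.HodgeKum4.Kum4NonInvariantClassesAlgebraic :=
  kum4NonInvariantClassesAlgebraic_of (kum4TranslationGroup_of_literature hcardF hF)
    (kum4FixedFourfoldClasses_of_L1_of_meetsTranslates hA1 hA2 hHIR hGS hGK hF hcardF hFu hS1 hL1 hgeo)

/-- **Glue shape for the planner's flat split of L3°** (children F_Γ, L1, I1geo): the route-level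
`Kum4TranslationGroup` (F_Γ) taken as a hypothesis instead of being re-derived from print; the printed
facts remain cited hypotheses. -/
theorem kum4NonInvariantClassesAlgebraic_of_translationGroup_of_L1_of_meetsTranslates
    (hA1 : Hirzebruch1969_gSignature_involution_halfDimFixedLocus)
    (hA2 : Floccari2026_fixedFourfold_kum4Type)
    (hHIR : Voisin2002_hodgeIndex_hodgeRiemann_middle)
    (hGS : GoettscheSoergel1993_chiY_kum4Type)
    (hGK : GreenKimLazaRobles2022_llvTrivial_isOfHodgeType_kumType)
    (hF : Foster2024_translationAction_kum4Type)
    (hcardF : Floccari2026_card_autFixingH2H3_kum4Type)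
    (hFu : Fulton1998_cupPairing_transversalPoint)
    (hS1 : Andre1996_dualLefschetz_mem_adjoin_lefschetzInvolution)
    (hΓ : Kum4TranslationGroup) (hL1 : LefschetzGenerationKum4) (hgeo : Kum4FixedFourfoldMeetsTranslates) :
    Summit.Ventures.HodgeKum4.Kum4NonInvariantClassesAlgebraic :=
  kum4NonInvariantClassesAlgebraic_of hΓ
    (kum4FixedFourfoldClasses_of_L1_of_meetsTranslates hA1 hA2 hHIR hGS hGK hF hcardF hFu hS1 hL1 hgeo)

end Summit.Ventures.HodgeKum4

end
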